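import Summits.AtomisticToContinuum.FouriersLaw.Theorems.BondHeatUncertaintyExtensiveSnapshotIrreversibilityEnergyWindowDepartureGlueA

/-!
# Energy window, part W-6 — the DEPARTURE GLUE — file 2 of 3 (sequel of `…BondHeatUncertaintyExtensiveSnapshotIrreversibilityEnergyWindowDepartureGlueA`)

Split for the 400-line cap; the module docstring of file 1 describes the whole part.
This file holds §4 (path-level departure bound) and §5 (Fubini–FTC over the momentum segment).
Same namespace, same section variables; no instance / notation / option; no proof holes.
[folklore]
-/

noncomputable section

namespace Summit.AtomisticToContinuum.FouriersLaw.Theorems.ExtensiveSnapshotIrreversibility.EnergyWindow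

open MeasureTheory ProbabilityTheory Filter Topology Set
open scoped ENNReal NNReal Matrix ContDiff
open Literature.MathematicalPhysics.KineticTheory.HeatConduction
open Literature.Probability.Process
open Literature.Probability.Distributions

section Departure

variable {ω₂ lam β γ : ℝ} (hω : 0 < ω₂) (hl : 0 < lam) (hβ : 0 < β) (hγ : 0 < γ) {N : ℕ}
  (hN : 0 < N) {T T_L T_R : ℝ} (hT : 0 < T) (hTL : T / 2 ≤ T_L) (hTL' : T_L ≤ 2 * T)
  (hTR : T / 2 ≤ T_R) (hTR' : T_R ≤ 2 * T)

/-! ## 4. The path-level departure bound -/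

include hω hl hβ hγ hN hT hTL hTL' hTR hTR' in
/-- ★ **Path-level departure bound** (baths in `[T/2, 2T]`, `s ∈ [0,1]`, `g ∈ C¹_c`): if
`E|g(E_m)|^p ≤ A₁^p` at every level and the regularised departure weights have `q`-th moments
`≤ A₂^q` eventually in the level for every `κ > 0` ((SWM)_d-shape), then
`|E[∂_{p_b}(g ∘ E_m(·,B))(z)]| ≤ A₁ A₂` — by the departure identity (T-b), Hölder, and the
vanishing defect ((I-s2)ₛ pointwise, W-0) in the random direction `V`. [folklore] -/
theorem abs_integral_partialP_dep_le {p q : ℝ} (hpq : p.HolderConjugate q) {s : ℝ}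
    (hs : s ∈ Icc (0 : ℝ) 1) (b : Fin N) (z : PhaseSpace N)
    (hsurj : ∀ wp : WienerPair, ∃ m₀ : ℕ, ∀ m, m₀ ≤ m → LinearMap.range
      (fderiv ℝ (skelFlowMapAt ω₂ lam β γ N T_L T_R s m z (pairRem m wp)) (pairSkel m wp) :
        PairSkeleton m →ₗ[ℝ] PhaseSpace N) = ⊤)
    {g : PhaseSpace N → ℝ} (hg : ContDiff ℝ 1 g) (hgc : HasCompactSupport g) {A₁ A₂ : ℝ}
    (hA₁ : 0 ≤ A₁) (hA₂ : 0 ≤ A₂)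
    (h1 : ∀ m : ℕ, ∫⁻ wp, ENNReal.ofReal |g (skelFlowMapAt ω₂ lam β γ N T_L T_R s m z
        (pairRem m wp) (pairSkel m wp))| ^ p ∂wienerPair ≤ ENNReal.ofReal (A₁ ^ p))
    (h2 : ∀ κ : ℝ, 0 < κ → ∃ m₁ : ℕ, ∀ m : ℕ, m₁ ≤ m →
        skelMoment m q (skelWeightDep ω₂ lam β γ N T_L T_R s m κ b z) ≤ ENNReal.ofReal (A₂ ^ q))
    (m : ℕ) :
    |∫ wp, partialP b (fun z' => g (skelFlowMapAt ω₂ lam β γ N T_L T_R s m z' (pairRem m wp)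
        (pairSkel m wp))) z ∂wienerPair| ≤ A₁ * A₂ := by
  -- bounds on `g` and `Dg`
  obtain ⟨M₀, hM₀⟩ := hg.continuous.bounded_above_of_compact_support hgc
  have hgM : ∀ w, |g w| ≤ M₀ := fun w => by rw [← Real.norm_eq_abs]; exact hM₀ w
  obtain ⟨L₀, hL₀⟩ := (hg.continuous_fderiv one_ne_zero).bounded_above_of_compact_support
    (hgc.fderiv (𝕜 := ℝ))
  have hL : 0 ≤ max L₀ 0 := le_max_right _ _
  have hgL : ∀ w v, |fderiv ℝ g w v| ≤ max L₀ 0 * ‖v‖ := fun w v => by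
    rw [← Real.norm_eq_abs]
    exact (fderiv ℝ g w).le_of_opNorm_le ((hL₀ w).trans (le_max_left _ _)) v
  -- the left side does not depend on the level
  have hlev : ∀ k : ℕ, ∫ wp, partialP b (fun z' => g (skelFlowMapAt ω₂ lam β γ N T_L T_R s k z'
      (pairRem k wp) (pairSkel k wp))) z ∂wienerPair = ∫ wp, partialP b (fun z' =>
        g ((pinnedChain ω₂ lam β γ).solMap N T_L T_R s z' (pairPath wp))) z ∂wienerPair := by
    intro k
    congr 1
    funext wp
    have hfun : (fun z' => g (skelFlowMapAt ω₂ lam β γ N T_L T_R s k z' (pairRem k wp)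
        (pairSkel k wp))) = fun z' => g ((pinnedChain ω₂ lam β γ).solMap N T_L T_R s z'
          (pairPath wp)) := by
      funext z'
      rw [pinnedChain_solMap_eq_skelFlowMapAt hω hl.le hβ.le hγ.le N T_L T_R hs k z' wp]
    rw [hfun]
  refine le_of_forall_pos_le_add fun ε hε => ?_
  -- the defect level `n`
  have hLp : 0 < max L₀ 0 + 1 := add_pos_of_nonneg_of_pos hL one_pos
  have hη : 0 < ε / (max L₀ 0 + 1) := div_pos hε hLp
  obtain ⟨n, hn⟩ := exists_lintegral_sqrt_defectSq_le hω hl.le hβ.le hγ.le N T_L T_R hs z hsurj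
    (e := depVecPath ω₂ lam β γ N T_L T_R s b z)
    (measurable_depVecPath_apply hω hl hβ hγ hs b z)
    (lintegral_sqrt_dotProduct_depVecPath_ne_top hω hl hβ hγ hN hT hTL hTL' hTR hTR' hs b z) hη
  have hκ : 0 < ((n : ℝ) + 1)⁻¹ := inv_natCast_succ_pos n
  obtain ⟨m₁, hm₁⟩ := h2 _ hκ
  -- work at the level `m' = max n m₁`
  rw [hlev m, ← hlev (max n m₁)]
  have hId := integral_mul_skelWeightDep_eq hω hl.le hβ.le hγ.le N T_L T_R hs (max n m₁) hκ b z hg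
    (fun j => integrable_mul_skelFieldDep hω hl hβ hγ hN hT hTL hTL' hTR hTR' hs _ hκ b z hg hgM j)
    (fun j => integrable_coordX_mul_mul_skelFieldDep hω hl hβ hγ hN hT hTL hTL' hTR hTR' hs _ hκ b
      z hg hgM j)
    (fun j => integrable_fderiv_comp_mul_skelFieldDep hω hl hβ hγ hN hT hTL hTL' hTR hTR' hs _ hκ b
      z hg hgL j)
    (fun j => integrable_mul_fderiv_skelFieldDep hω hl hβ hγ hN hT hTL hTL' hTR hTR' hs _ hκ b
      z hg hgM j)
  rw [integral_sub (integrable_partialP_dep_path hω hl hβ hγ hN hT hTL hTL' hTR hTR' hs _ b z hg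
      hgL) (integrable_depDefectTerm hω hl hβ hγ hN hT hTL hTL' hTR hTR' hs z b hg hL hgL
      (le_max_left n m₁))] at hId
  have hHol := abs_integral_mul_le_of_holder wienerPair hpq
    (measurable_comp_skelFlowMapAt_path hω hl hβ hγ s (max n m₁) z hg.continuous)
    (measurable_skelWeightDep_path hω hl hβ hγ hs (max n m₁) hκ b z) hA₁ hA₂ (h1 _)
    (hm₁ _ (le_max_right _ _))
  have hDef := abs_integral_depDefectTerm_le hω hl hβ hγ hs (max n m₁) z b hL hgL
    (le_max_left n m₁) hη.le hn
  have hLε : max L₀ 0 * (ε / (max L₀ 0 + 1)) ≤ ε := by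
    rw [mul_div_assoc', div_le_iff₀ hLp]
    nlinarith [hL, hε.le]
  have hA : ∫ wp, partialP b (fun z' => g (skelFlowMapAt ω₂ lam β γ N T_L T_R s (max n m₁) z'
      (pairRem (max n m₁) wp) (pairSkel (max n m₁) wp))) z ∂wienerPair =
      (∫ wp, g (skelFlowMapAt ω₂ lam β γ N T_L T_R s (max n m₁) z (pairRem (max n m₁) wp)
          (pairSkel (max n m₁) wp)) * skelWeightDep ω₂ lam β γ N T_L T_R s (max n m₁)
            ((n : ℝ) + 1)⁻¹ b z (pairRem (max n m₁) wp) (pairSkel (max n m₁) wp) ∂wienerPair) +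
      ∫ wp, ((n : ℝ) + 1)⁻¹ * fderiv ℝ g (skelFlowMapAt ω₂ lam β γ N T_L T_R s (max n m₁) z
        (pairRem (max n m₁) wp) (pairSkel (max n m₁) wp)) (ofCoordV N (skelCtrlDep ω₂ lam β γ N
          T_L T_R s (max n m₁) ((n : ℝ) + 1)⁻¹ b z (pairRem (max n m₁) wp)
            (pairSkel (max n m₁) wp))) ∂wienerPair := by
    linarith [hId]
  rw [hA]
  exact (abs_add_le _ _).trans (add_le_add hHol (hDef.trans hLε))

/-! ## 5. Fubini–FTC: the kernel difference as an integral over the momentum segment -/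

include hω hl hβ hγ hN hT hTL hTL' hTR hTR' in
/-- **`E[g(E(z + c v₀))] − E[g(E(z))] = c ∫₀¹ E[∂_{p_b}(g ∘ E)(z + τc v₀)] dτ`** for bounded
`g ∈ C¹` with bounded derivative (`v₀ = (0, e_b)`): pathwise FTC (§2) and Fubini, the latter by
Tonelli on the dominator `L‖∂_zE[(0,e_b)]‖`, whose first moment is bounded on the segment
((JMᶻ), §1). [folklore] -/
theorem integral_comp_sub_eq_mul_integral_partialP {s : ℝ} (hs : s ∈ Icc (0 : ℝ) 1) (m : ℕ)
    (b : Fin N) (z : PhaseSpace N) (c : ℝ) {g : PhaseSpace N → ℝ} (hg : ContDiff ℝ 1 g) {M₀ : ℝ}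
    (hgM : ∀ w, |g w| ≤ M₀) {L : ℝ} (hgL : ∀ w v, |fderiv ℝ g w v| ≤ L * ‖v‖) :
    (∫ wp, g (skelFlowMapAt ω₂ lam β γ N T_L T_R s m
        (z + c • (((0 : Fin N → ℝ), Pi.single b 1) : PhaseSpace N)) (pairRem m wp) (pairSkel m wp))
        ∂wienerPair) -
        ∫ wp, g (skelFlowMapAt ω₂ lam β γ N T_L T_R s m z (pairRem m wp) (pairSkel m wp))
          ∂wienerPair =
      c * ∫ τ in (0 : ℝ)..1, ∫ wp, partialP b
        (fun z' => g (skelFlowMapAt ω₂ lam β γ N T_L T_R s m z' (pairRem m wp) (pairSkel m wp)))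
        (z + (τ * c) • (((0 : Fin N → ℝ), Pi.single b 1) : PhaseSpace N)) ∂wienerPair := by
  set v₀ : PhaseSpace N := ((0 : Fin N → ℝ), Pi.single b 1) with hv₀
  -- integrability of `g ∘ E`
  have hgi : ∀ z' : PhaseSpace N, Integrable (fun wp : WienerPair =>
      g (skelFlowMapAt ω₂ lam β γ N T_L T_R s m z' (pairRem m wp) (pairSkel m wp))) wienerPair :=
    fun z' => Integrable.mono' (integrable_const M₀)
      (measurable_comp_skelFlowMapAt_path hω hl hβ hγ s m z' hg.continuous).aestronglyMeasurable
      (Eventually.of_forall fun wp => by rw [Real.norm_eq_abs]; exact hgM _)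
  rw [← integral_sub (hgi _) (hgi _)]
  have hpath : ∀ wp : WienerPair,
      g (skelFlowMapAt ω₂ lam β γ N T_L T_R s m (z + c • v₀) (pairRem m wp) (pairSkel m wp)) -
        g (skelFlowMapAt ω₂ lam β γ N T_L T_R s m z (pairRem m wp) (pairSkel m wp)) =
      ∫ τ in (0 : ℝ)..1, c * partialP b (fun z' => g (skelFlowMapAt ω₂ lam β γ N T_L T_R s m z'
        (pairRem m wp) (pairSkel m wp))) (z + (τ * c) • v₀) := fun wp =>
    comp_skelFlowMapAt_add_smul_sub_eq hω hl.le hβ.le hγ.le N T_L T_R hs m b z c (pairRem m wp)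
      (pairSkel m wp) hg
  simp_rw [hpath]
  rw [← intervalIntegral.integral_const_mul]
  simp_rw [← integral_const_mul]
  refine (intervalIntegral_integral_swap (μ := wienerPair) (f := fun (τ : ℝ) (wp : WienerPair) =>
    c * partialP b (fun z' => g (skelFlowMapAt ω₂ lam β γ N T_L T_R s m z' (pairRem m wp)
      (pairSkel m wp))) (z + (τ * c) • v₀)) ?_).symm
  -- joint measurability
  have hι : Measurable fun q : ℝ × WienerPair => ((z + (q.1 * c) • v₀,
      (pairSkel m q.2, pairRem m q.2)) : PhaseSpace N × (PairSkeleton m × WienerPair)) :=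
    (((measurable_fst.mul_const c).smul_const v₀).const_add z).prodMk
      ((measurable_pairSkel_prodMk_pairRem m).comp measurable_snd)
  have hEm : Measurable fun q : ℝ × WienerPair => skelFlowMapAt ω₂ lam β γ N T_L T_R s m
      (z + (q.1 * c) • v₀) (pairRem m q.2) (pairSkel m q.2) := by
    have h := (measurable_skelFlowMapAt_uncurry hω hl.le hβ.le hγ.le N T_L T_R s m).comp hι
    exact h
  have hJm : Measurable fun q : ℝ × WienerPair => fderiv ℝ (fun y =>
      skelFlowMapAt ω₂ lam β γ N T_L T_R s m y (pairRem m q.2) (pairSkel m q.2))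
        (z + (q.1 * c) • v₀) v₀ := by
    have h := (measurable_fderiv_skelFlowMapAt_left_uncurry hω hl.le hβ.le hγ.le N T_L T_R hs m
      v₀).comp hι
    exact h
  have hcont : Continuous fun p : PhaseSpace N × PhaseSpace N => fderiv ℝ g p.1 p.2 :=
    ((hg.continuous_fderiv one_ne_zero).comp continuous_fst).clm_apply continuous_snd
  have hPeq : ∀ (τ : ℝ) (wp : WienerPair), partialP b (fun z' => g (skelFlowMapAt ω₂ lam β γ N
      T_L T_R s m z' (pairRem m wp) (pairSkel m wp))) (z + (τ * c) • v₀) =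
      fderiv ℝ g (skelFlowMapAt ω₂ lam β γ N T_L T_R s m (z + (τ * c) • v₀) (pairRem m wp)
        (pairSkel m wp)) (fderiv ℝ (fun y => skelFlowMapAt ω₂ lam β γ N T_L T_R s m y (pairRem m wp)
          (pairSkel m wp)) (z + (τ * c) • v₀) v₀) := fun τ wp =>
    partialP_comp_skelFlowMapAt_eq hω hl.le hβ.le hγ.le N T_L T_R hs m b (z + (τ * c) • v₀)
      (pairRem m wp) (pairSkel m wp) hg
  have hPm : Measurable fun q : ℝ × WienerPair => c * partialP b (fun z' =>
      g (skelFlowMapAt ω₂ lam β γ N T_L T_R s m z' (pairRem m q.2) (pairSkel m q.2)))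
        (z + (q.1 * c) • v₀) := by
    have h := (hcont.measurable.comp (hEm.prodMk hJm)).const_mul c
    have hfun : (fun q : ℝ × WienerPair => c * partialP b (fun z' =>
        g (skelFlowMapAt ω₂ lam β γ N T_L T_R s m z' (pairRem m q.2) (pairSkel m q.2)))
          (z + (q.1 * c) • v₀)) = fun q : ℝ × WienerPair => c * fderiv ℝ g
        (skelFlowMapAt ω₂ lam β γ N T_L T_R s m (z + (q.1 * c) • v₀) (pairRem m q.2)
          (pairSkel m q.2)) (fderiv ℝ (fun y => skelFlowMapAt ω₂ lam β γ N T_L T_R s m y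
            (pairRem m q.2) (pairSkel m q.2)) (z + (q.1 * c) • v₀) v₀) :=
      funext fun q => by rw [hPeq]
    rw [hfun]
    exact h
  -- the first moment of the starting-point variation, uniformly on the segment
  obtain ⟨C₁, hC₁⟩ := skeletonStartVariationMoments ω₂ lam β γ hω hl hβ hγ T hT N hN 1 1 le_rfl
    one_pos
  have hinner : ∀ τ ∈ uIoc (0 : ℝ) 1, ∫⁻ wp, ENNReal.ofReal ‖fderiv ℝ (fun y =>
      skelFlowMapAt ω₂ lam β γ N T_L T_R s m y (pairRem m wp) (pairSkel m wp)) (z + (τ * c) • v₀)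
        v₀‖ ∂wienerPair ≤ ENNReal.ofReal (|C₁| * ‖v₀‖ * Real.exp (max
          ((pinnedChain ω₂ lam β γ).hamiltonian N z)
          ((pinnedChain ω₂ lam β γ).hamiltonian N (z + c • v₀)))) := by
    intro τ hτ
    rw [uIoc_of_le zero_le_one] at hτ
    have hτ' : τ ∈ Icc (0 : ℝ) 1 := ⟨hτ.1.le, hτ.2⟩
    have h1 := hC₁ T_L T_R hTL hTL' hTR hTR' s hs.1 hs.2 m (z + (τ * c) • v₀) v₀
    simp only [ENNReal.rpow_one, Real.rpow_one, one_mul] at h1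
    refine h1.trans (ENNReal.ofReal_le_ofReal ?_)
    have hH := hamiltonian_segment_le_max (pinnedChain ω₂ lam β γ) z b c hτ'
    calc C₁ * ‖v₀‖ * Real.exp ((pinnedChain ω₂ lam β γ).hamiltonian N (z + (τ * c) • v₀))
        ≤ |C₁| * ‖v₀‖ * Real.exp ((pinnedChain ω₂ lam β γ).hamiltonian N (z + (τ * c) • v₀)) :=
          mul_le_mul_of_nonneg_right (mul_le_mul_of_nonneg_right (le_abs_self _) (norm_nonneg _))
            (Real.exp_pos _).le
      _ ≤ _ := mul_le_mul_of_nonneg_left (Real.exp_le_exp.2 hH) (by positivity)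
  -- the integrable dominator `|c| L ‖∂_z E[v₀]‖` on `[0,1] × Ω`
  have hJint : Integrable (fun q : ℝ × WienerPair => ‖fderiv ℝ (fun y =>
      skelFlowMapAt ω₂ lam β γ N T_L T_R s m y (pairRem m q.2) (pairSkel m q.2))
        (z + (q.1 * c) • v₀) v₀‖) ((volume.restrict (uIoc (0 : ℝ) 1)).prod wienerPair) := by
    refine ⟨hJm.norm.aestronglyMeasurable, ?_⟩
    rw [hasFiniteIntegral_iff_norm]
    simp_rw [norm_norm]
    calc ∫⁻ q, ENNReal.ofReal ‖fderiv ℝ (fun y => skelFlowMapAt ω₂ lam β γ N T_L T_R s m y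
          (pairRem m q.2) (pairSkel m q.2)) (z + (q.1 * c) • v₀) v₀‖
            ∂((volume.restrict (uIoc (0 : ℝ) 1)).prod wienerPair)
        = ∫⁻ τ, ∫⁻ wp, ENNReal.ofReal ‖fderiv ℝ (fun y => skelFlowMapAt ω₂ lam β γ N T_L T_R s m y
            (pairRem m wp) (pairSkel m wp)) (z + (τ * c) • v₀) v₀‖ ∂wienerPair
              ∂(volume.restrict (uIoc (0 : ℝ) 1)) :=
          lintegral_prod (fun q : ℝ × WienerPair => ENNReal.ofReal ‖fderiv ℝ (fun y =>
            skelFlowMapAt ω₂ lam β γ N T_L T_R s m y (pairRem m q.2) (pairSkel m q.2))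
              (z + (q.1 * c) • v₀) v₀‖) hJm.norm.ennreal_ofReal.aemeasurable
      _ ≤ ∫⁻ _τ, ENNReal.ofReal (|C₁| * ‖v₀‖ * Real.exp (max
            ((pinnedChain ω₂ lam β γ).hamiltonian N z)
            ((pinnedChain ω₂ lam β γ).hamiltonian N (z + c • v₀))))
              ∂(volume.restrict (uIoc (0 : ℝ) 1)) :=
          lintegral_mono_ae ((ae_restrict_iff' measurableSet_uIoc).2 (Eventually.of_forall hinner))
      _ = _ := lintegral_const _
      _ < ⊤ := by
          rw [Measure.restrict_apply_univ, Real.volume_uIoc]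
          exact ENNReal.mul_lt_top ENNReal.ofReal_lt_top ENNReal.ofReal_lt_top
  refine ((hJint.const_mul L).const_mul |c|).mono' hPm.aestronglyMeasurable
    (Eventually.of_forall fun q => ?_)
  show ‖c * partialP b (fun z' => g (skelFlowMapAt ω₂ lam β γ N T_L T_R s m z' (pairRem m q.2)
      (pairSkel m q.2))) (z + (q.1 * c) • v₀)‖ ≤ _
  rw [Real.norm_eq_abs, abs_mul, hPeq]
  exact mul_le_mul_of_nonneg_left (hgL _ _) (abs_nonneg c)

end Departure

end Summit.AtomisticToContinuum.FouriersLaw.Theorems.ExtensiveSnapshotIrreversibility.EnergyWindow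

end
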